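import Literature.NumberTheory.CubicFields.PureCubicEmbeddingValues
import HarnessLib

/-!
# Exact sign tests for the conjugates of a complex cubic field through the norm form

Topic `NumberTheory/CubicFields`, sub-namespace `PureCubicLexMin`. For a cubic field `K` of
signature `(1, 1)` with real embedding `σ₁` and non-real embedding `σ₂`, `N(x) = σ₁ x · ‖σ₂ x‖²`
(`norm_eq_mul_norm_sq`), so every comparison the infrastructure algorithms need is an EXACT rational
sign test (Buchmann–Williams; Cohen GTM 138 §6.5):

* `sigma1_pos_iff` : `0 < σ₁ x ↔ 0 < N x`; `sigma1_lt_iff` : `σ₁ x < σ₁ y ↔ 0 < N (y − x)`;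
* `norm_sigma2_lt_one_iff` : for `σ₁ x > 0`, `‖σ₂ x‖ < 1 ↔ 0 < N (x − N x)`;

and, for the pure cubic field `ℚ(θ)`, `θ³ = ab²`, in the coordinates `w = (x, y, z)` of
`φ = (x + yθ + zθ₂)/den` (`PureCubicCodes.lin`, norm form `PureCubicCodes.normRow`):

* `norm_lin_div` : `N(lin w / d) = normRow w / d³`;
* `sigma1_lin_div_pos_iff`, `sigma1_lin_div_lt_iff`, `norm_sigma2_lin_div_lt_one_iff` : the three
  tests of the program `lexE` (`nrmW`, `ltW`, `cylW` of `PureCubicLexMinProgram.lean`) decide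
  `σ₁ φ > 0`, `σ₁ φ' < σ₁ φ`, `‖σ₂ φ‖ < 1`.

## References

* H. Cohen, *A Course in Computational Algebraic Number Theory*, GTM 138 (1993), §6.5. [Cohen1993]
* J. Buchmann, H. C. Williams, *On the infrastructure of the principal ideal class of an algebraic
  number field of unit rank one*, Math. Comp. 50 (1988). [folklore]
-/

noncomputable section

namespace Literature.NumberTheory.CubicFields

namespace PureCubicLexMin

open Literature.NumberTheory.NumberFields Literature.NumberTheory.NumberFields.PureCubic
  PureCubicCodes
open scoped NumberField ComplexConjugate

/-! ### Field-level tests -/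

section FieldLevel

variable {K : Type*} [Field K] [NumberField K] (σ₁ : K →+* ℝ) (σ₂ : K →+* ℂ)
  (hdeg : Module.finrank ℚ K = 3) (hσ₂ : ∃ z : K, conj (σ₂ z) ≠ σ₂ z)
include hdeg hσ₂

/-- **The sign of the real conjugate is the sign of the norm**: `0 < σ₁ x ↔ 0 < N x`
(`N x = σ₁ x ‖σ₂ x‖²`). [cite: Cohen1993, §6.5] -/
theorem sigma1_pos_iff (x : K) : 0 < σ₁ x ↔ 0 < Algebra.norm ℚ x := by
  have h := norm_eq_mul_norm_sq σ₁ σ₂ hdeg hσ₂ x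
  by_cases hx : x = 0
  · subst hx; simp
  have hpos : 0 < ‖σ₂ x‖ ^ 2 := by
    have : σ₂ x ≠ 0 := (map_ne_zero σ₂).2 hx
    positivity
  rw [← Rat.cast_pos (K := ℝ), h]
  constructor
  · intro h1; positivity
  · intro h1; exact pos_of_mul_pos_left h1 hpos.le

/-- **Comparison of real conjugates**: `σ₁ x < σ₁ y ↔ 0 < N (y − x)`. [cite: Cohen1993, §6.5] -/
theorem sigma1_lt_iff (x y : K) : σ₁ x < σ₁ y ↔ 0 < Algebra.norm ℚ (y - x) := by
  rw [← sigma1_pos_iff σ₁ σ₂ hdeg hσ₂, map_sub, sub_pos]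

/-- **The cylinder test**: for `σ₁ x > 0`, `‖σ₂ x‖ < 1 ↔ N x < σ₁ x ↔ 0 < N (x − N x)`. [cite: Cohen1993, §6.5] -/
theorem norm_sigma2_lt_one_iff {x : K} (hx : 0 < σ₁ x) :
    ‖σ₂ x‖ < 1 ↔ 0 < Algebra.norm ℚ (x - algebraMap ℚ K (Algebra.norm ℚ x)) := by
  rw [← sigma1_pos_iff σ₁ σ₂ hdeg hσ₂, map_sub, sub_pos]
  have hc : σ₁ (algebraMap ℚ K (Algebra.norm ℚ x)) = ((Algebra.norm ℚ x : ℚ) : ℝ) := by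
    rw [← map_ratCast σ₁, eq_ratCast]
  rw [hc, norm_eq_mul_norm_sq σ₁ σ₂ hdeg hσ₂ x]
  constructor
  · intro h
    have h2 : ‖σ₂ x‖ ^ 2 < 1 := by
      rw [pow_lt_one_iff_of_nonneg (norm_nonneg _) two_ne_zero]; exact h
    nlinarith
  · intro h
    have h2 : ‖σ₂ x‖ ^ 2 < 1 := by
      by_contra hcon
      push Not at hcon
      nlinarith
    rwa [pow_lt_one_iff_of_nonneg (norm_nonneg _) two_ne_zero] at h2

end FieldLevel

/-! ### Coordinates: the norm of `lin w / d` -/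

section Coordinates

variable {K : Type*} [Field K] [NumberField K] {a b : ℕ} {θ : K}
  (hdeg : Module.finrank ℚ K = 3) (hab : Squarefree (a * b)) (hab1 : a * b ≠ 1)
  (hθ : θ ^ 3 = ((a * b ^ 2 : ℕ) : K))
include hdeg hab hab1 hθ

/-- **The norm of `(x + yθ + zθ₂)/d`** is `normRow (x, y, z) / d³` (the norm form of Dedekind's basis,
`PureCubic.norm_order`). [cite: Cohen1993, §6.4.5] -/
theorem norm_lin_div (w : Row) (d : ℕ) (hd : d ≠ 0) :
    Algebra.norm ℚ (lin θ b w / (d : K)) = (normRow a b w : ℚ) / (d : ℚ) ^ 3 := by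
  have hdQ : (d : ℚ) ≠ 0 := Nat.cast_ne_zero.2 hd
  have hrw : lin θ b w / (d : K) = (((w.1 / d : ℚ)) : K) + (((w.2.1 / d : ℚ)) : K) * θ +
      (((w.2.2 / d : ℚ)) : K) * (θ ^ 2 / (b : K)) := by
    simp only [lin, Rat.cast_div, Rat.cast_intCast, Rat.cast_natCast]
    ring
  rw [hrw, norm_order hdeg hab hab1 hθ]
  simp only [normRow]
  push_cast
  field_simp

omit [NumberField K] hdeg hab hab1 hθ in
/-- `lin` is additive. [folklore] -/
theorem lin_sub (w w' : Row) : lin θ b (w - w') = lin θ b w - lin θ b w' := by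
  simp only [lin, Prod.fst_sub, Prod.snd_sub, Int.cast_sub]
  ring

variable (σ₁ : K →+* ℝ) (σ₂ : K →+* ℂ) (hσ₂ : ∃ z : K, conj (σ₂ z) ≠ σ₂ z)
include hσ₂

/-- **The sign test** `nrmW`: `0 < σ₁ (lin w / d) ↔ 0 < normRow w` (`d ≥ 1`). [cite: Cohen1993, §6.5] -/
theorem sigma1_lin_div_pos_iff (w : Row) (d : ℕ) (hd : d ≠ 0) :
    0 < σ₁ (lin θ b w / (d : K)) ↔ 0 < normRow a b w := by
  rw [sigma1_pos_iff σ₁ σ₂ hdeg hσ₂, norm_lin_div hdeg hab hab1 hθ w d hd]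
  have hdQ : (0 : ℚ) < (d : ℚ) ^ 3 := by positivity
  rw [div_pos_iff_of_pos_right hdQ, Int.cast_pos]

/-- **The comparison test** `ltW`: `σ₁ (lin w' / d) < σ₁ (lin w / d) ↔ normRow (w' − w) < 0`.
[cite: Cohen1993, §6.5] -/
theorem sigma1_lin_div_lt_iff (w w' : Row) (d : ℕ) (hd : d ≠ 0) :
    σ₁ (lin θ b w' / (d : K)) < σ₁ (lin θ b w / (d : K)) ↔ normRow a b (w' - w) < 0 := by
  rw [sigma1_lt_iff σ₁ σ₂ hdeg hσ₂, ← sub_div, ← lin_sub, norm_lin_div hdeg hab hab1 hθ _ d hd]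
  have hdQ : (0 : ℚ) < (d : ℚ) ^ 3 := by positivity
  rw [div_pos_iff_of_pos_right hdQ, Int.cast_pos]
  have hneg : normRow a b (w - w') = -normRow a b (w' - w) := by
    simp only [normRow, Prod.fst_sub, Prod.snd_sub]; ring
  rw [hneg, neg_pos]

/-- **The cylinder test** `cylW`: for `σ₁ φ > 0`, `φ = lin w / d`,
`‖σ₂ φ‖ < 1 ↔ 0 < normRow (d² x − normRow w, d² y, d² z)` (`φ − N φ = lin(d² w − (N, 0, 0)) / d³`).
[cite: Cohen1993, §6.5] -/
theorem norm_sigma2_lin_div_lt_one_iff (w : Row) (d : ℕ) (hd : d ≠ 0)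
    (hpos : 0 < σ₁ (lin θ b w / (d : K))) :
    ‖σ₂ (lin θ b w / (d : K))‖ < 1 ↔
      0 < normRow a b ((d : ℤ) ^ 2 * w.1 - normRow a b w, (d : ℤ) ^ 2 * w.2.1, (d : ℤ) ^ 2 * w.2.2) := by
  rw [norm_sigma2_lt_one_iff σ₁ σ₂ hdeg hσ₂ hpos, norm_lin_div hdeg hab hab1 hθ w d hd]
  have hdK : (d : K) ≠ 0 := Nat.cast_ne_zero.2 hd
  have hrw : lin θ b w / (d : K) - algebraMap ℚ K ((normRow a b w : ℚ) / (d : ℚ) ^ 3) =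
      lin θ b ((d : ℤ) ^ 2 * w.1 - normRow a b w, (d : ℤ) ^ 2 * w.2.1, (d : ℤ) ^ 2 * w.2.2) /
        ((d ^ 3 : ℕ) : K) := by
    rw [eq_ratCast, Rat.cast_div, Rat.cast_intCast, Rat.cast_pow, Rat.cast_natCast]
    simp only [lin, Int.cast_sub, Int.cast_mul, Int.cast_pow, Int.cast_natCast, Nat.cast_pow]
    field_simp
    ring
  rw [hrw, ← sigma1_pos_iff σ₁ σ₂ hdeg hσ₂,
    sigma1_lin_div_pos_iff hdeg hab hab1 hθ σ₁ σ₂ hσ₂ _ (d ^ 3) (pow_ne_zero 3 hd)]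

end Coordinates

end PureCubicLexMin

end Literature.NumberTheory.CubicFields

end
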